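import Summits.ValiantsHypothesis.ValiantsHypothesis.Theorems.GrenetZeonDualUnipotentThreeHalvesLongMassHomogenise
import Summits.ValiantsHypothesis.ValiantsHypothesis.Theorems.GrenetZeonDualUnipotentThreeHalvesLongMassLedgerIndexShadowSpace

/-!
# `GrenetZeon.DualUnipotentThreeHalves` (stmt-ValiantsHypothesis-24318), line `slow_core`, stub (c) `SlowCore.LongMassSlowLawInv`:
# FREE RE-PARAMETRISATION — (c) is a statement about nilpotent matrix subspaces with a basis on coordinates

Sequel of ✓ `…LongMassHomogenise` (constant part free) and ✓ `…LongMassValueSpace` (the price is an invariant of the value space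
`W̄(N) = {linMat N v}`).  Call a linear pencil `B` FREE if its non-zero coefficient matrices `[x_e]B = linMat B δ_e` are linearly independent,
i.e. `linMat B v = 0 → ∀ e, linMat B δ_e ≠ 0 → v e = 0` (then the mass of `B` is the number of coordinates it uses, and `B` is the value space
`W̄(B)` written in a basis placed on distinct coordinates).

* ★★ `exists_free_of_linear` — every linear affine pencil `N` over the `n²` coordinates has a FREE linear re-parametrisation `N₁` over the same
  coordinates with the SAME value space (a `Module.finBasis` of `range (v ↦ linMat N v)`, `dim ≤ n²`, placed along an injection
  `Fin (dim W̄) ↪ Fin n × Fin n`).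
* `pow_eq_zero_of_valueSpace_le` — nilpotency `B ^ b = 0` of a linear pencil only depends on (is inherited from any linear pencil containing) its
  value space (`MvPolynomial.funext`).
* the corollary «(c) ⟺ (c) for FREE LINEAR nilpotent pencils» is the sequel file `…LongMassValueSpaceFreeIff` (it also needs ✓
  `…LongMassValueSpace.relCert_of_valueSpace`).

So the registered research statement reads (sequel, BY NAME): «∃ c n₀, ∀ n ≥ n₀, every nilpotent matrix subspace `W̄ ≤ M_b(ℂ)` with `dim W̄ ≤ n²`,
written in ANY basis on distinct coordinates, has a whole-pencil certificate of price `≤ c·√n·b`» — mass = `dim W̄`, no parametrisation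
artefacts.  Honest framing.  A REFORMULATION (`--supports stmt-ValiantsHypothesis-24318`), NOT progress on (c): (c) `SlowCore.LongMassSlowLawInv`,
S3, the crux 24318, 8062 and `VP ≠ VNP` remain OPEN / NOT proved.  No sorry, no definitions, no named facts.
-/

-- single-conjunct layout: Sub = Summit, duplicated namespace component intended (the name is mandated)
set_option linter.dupNamespace false
set_option autoImplicit false

noncomputable section

namespace Summit.ValiantsHypothesis.ValiantsHypothesis.Theorems.GrenetZeon.LongMassHomogenise

open MvPolynomial Matrix
open scoped BigOperators
open Summit.ValiantsHypothesis.ValiantsHypothesis.Cruxes.TwoDimCoefficients.DimTwoCases (AffMat IsAffine)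
open Summit.ValiantsHypothesis.ValiantsHypothesis.Theorems.GrenetZeon.RadicalSplit (lineSubst)
open Summit.ValiantsHypothesis.ValiantsHypothesis.Theorems.GrenetZeon.SlowCore
open Summit.ValiantsHypothesis.ValiantsHypothesis.Theorems.GrenetZeon.ResolventFlag (linMat)
open Summit.ValiantsHypothesis.ValiantsHypothesis.Theorems.GrenetZeon.LedgerIndex (exists_linearMap_linMat)
variable {n b : ℕ}

/-! ## §1 Values of a linear pencil; nilpotency is a property of the value space -/

/-- The value of a LINEAR pencil at `x` is `linMat N x`. -/
theorem map_eval_eq_linMat_of_linear (N : AffMat n b) (hN : IsAffine N) (h0 : ∀ i j, coeff 0 (N i j) = 0)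
    (x : Fin n × Fin n → ℂ) : N.map (eval x) = linMat N x := by
  ext i j
  rw [Matrix.map_apply, linMat, Matrix.of_apply, eval_eq_of_totalDegree_le_one _ (hN i j), h0, zero_add, linEntry]
  exact Finset.sum_congr rfl fun e _ => mul_comm _ _

/-- ★ NILPOTENCY IS A PROPERTY OF THE VALUE SPACE: if `W̄(N₁) ⊆ W̄(N)` and `N ^ b = 0` then `N₁ ^ b = 0` (linear pencils). -/
theorem pow_eq_zero_of_valueSpace_le (N N₁ : AffMat n b) (hN : IsAffine N) (hN₁ : IsAffine N₁)
    (h0 : ∀ i j, coeff 0 (N i j) = 0) (h0₁ : ∀ i j, coeff 0 (N₁ i j) = 0)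
    (hge : ∀ v₁, ∃ v, linMat N₁ v₁ = linMat N v) (hnil : N ^ b = 0) : N₁ ^ b = 0 := by
  refine Matrix.ext fun i j => ?_
  apply MvPolynomial.funext
  intro y
  obtain ⟨x, hx⟩ := hge y
  have hval : N₁.map (eval y) = N.map (eval x) := by
    rw [map_eval_eq_linMat_of_linear N₁ hN₁ h0₁, map_eval_eq_linMat_of_linear N hN h0, hx]
  have h := Matrix.map_pow N (eval x) b
  rw [hnil, Matrix.map_zero _ (map_zero _)] at h
  have h₁ := Matrix.map_pow N₁ (eval y) b
  rw [hval, ← h] at h₁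
  have := congr_fun (congr_fun h₁ i) j
  rw [Matrix.map_apply, Matrix.zero_apply] at this
  rw [this, Matrix.zero_apply, map_zero]

/-! ## §2 The free re-parametrisation -/

/-- VALUE FORMULA for a pencil written in a family of matrices `M t` placed on the coordinates `φ t`:
`linMat N₁ v = Σ_t v(φ t) • M t`. -/
theorem linMat_of_placed {r : ℕ} (φ : Fin r → Fin n × Fin n) (M : Fin r → Matrix (Fin b) (Fin b) ℂ) (N₁ : AffMat n b)
    (hN₁ : ∀ i j, N₁ i j = ∑ t, C (M t i j) * X (φ t)) (v : Fin n × Fin n → ℂ) :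
    linMat N₁ v = ∑ t, v (φ t) • M t := by
  have haff : IsAffine N₁ := by
    intro i j
    rw [hN₁ i j]
    refine (totalDegree_finsetSum _ _).trans (Finset.sup_le fun t _ => ?_)
    exact (totalDegree_mul _ _).trans (by rw [totalDegree_C, totalDegree_X, zero_add])
  have h0 : ∀ i j, coeff 0 (N₁ i j) = 0 := by
    intro i j
    rw [hN₁ i j, coeff_sum]
    simp [coeff_C_mul]
  have hv := map_eval_eq_linMat_of_linear N₁ haff h0 v
  rw [← hv]
  ext i j
  rw [Matrix.map_apply, hN₁ i j]
  simp [eval_X, Matrix.sum_apply, mul_comm]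

/-- ★★ **FREE RE-PARAMETRISATION.**  Every pencil `N` over the `n²` coordinates (no hypothesis: only its linear coefficients `linMat N` enter)
has a LINEAR affine pencil `N₁` over the same coordinates with the SAME value space `{linMat N v} = {linMat N₁ v₁}` whose non-zero coefficient
matrices are LINEARLY INDEPENDENT. -/
theorem exists_free_of_linear (N : AffMat n b) :
    ∃ N₁ : AffMat n b, IsAffine N₁ ∧ (∀ i j, coeff 0 (N₁ i j) = 0) ∧
      (∀ v, ∃ v₁, linMat N v = linMat N₁ v₁) ∧ (∀ v₁, ∃ v, linMat N₁ v₁ = linMat N v) ∧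
      (∀ v, linMat N₁ v = 0 → ∀ e, linMat N₁ (Pi.single e 1) ≠ 0 → v e = 0) := by
  classical
  obtain ⟨T, hT⟩ := exists_linearMap_linMat N
  set L := LinearMap.range T with hL
  set r := Module.finrank ℂ L with hr
  let B := Module.finBasis ℂ L
  -- an injection `Fin r ↪ Fin n × Fin n`
  have hrn : r ≤ Fintype.card (Fin n × Fin n) := by
    have h1 : r ≤ Module.finrank ℂ (Fin n × Fin n → ℂ) := LinearMap.finrank_range_le T
    rwa [Module.finrank_fintype_fun_eq_card] at h1
  let φ : Fin r ↪ Fin n × Fin n := (Fin.castLEEmb hrn).trans (Fintype.equivFin (Fin n × Fin n)).symm.toEmbedding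
  -- the matrices of the basis, placed on the coordinates `φ t`
  let M : Fin r → Matrix (Fin b) (Fin b) ℂ := fun t => (B t : Matrix (Fin b) (Fin b) ℂ)
  let N₁ : AffMat n b := Matrix.of fun i j => ∑ t, C (M t i j) * X (φ t)
  have hN₁ : ∀ i j, N₁ i j = ∑ t, C (M t i j) * X (φ t) := fun i j => rfl
  have haff : IsAffine N₁ := by
    intro i j
    rw [hN₁ i j]
    refine (totalDegree_finsetSum _ _).trans (Finset.sup_le fun t _ => ?_)
    exact (totalDegree_mul _ _).trans (by rw [totalDegree_C, totalDegree_X, zero_add])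
  have h0₁ : ∀ i j, coeff 0 (N₁ i j) = 0 := by
    intro i j
    rw [hN₁ i j, coeff_sum]
    simp [coeff_C_mul]
  have hval : ∀ v, linMat N₁ v = ∑ t, v (φ t) • M t := linMat_of_placed φ M N₁ hN₁
  -- sums of basis matrices, as elements of `L`
  have hcoe : ∀ c : Fin r → ℂ, (∑ t, c t • M t) = ((∑ t, c t • B t : L) : Matrix (Fin b) (Fin b) ℂ) := by
    intro c
    rw [Submodule.coe_sum]
    exact Finset.sum_congr rfl fun t _ => by rw [Submodule.coe_smul]
  refine ⟨N₁, haff, h0₁, ?_, ?_, ?_⟩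
  · -- `W̄(N) ⊆ W̄(N₁)`: expand `T v ∈ L` in the basis
    intro v
    have hmem : T v ∈ L := LinearMap.mem_range_self T v
    set c : Fin r → ℂ := fun t => B.repr ⟨T v, hmem⟩ t with hc
    refine ⟨Function.extend φ c 0, ?_⟩
    rw [hval, ← hT]
    have hrepr : (∑ t, c t • B t : L) = ⟨T v, hmem⟩ := by
      simp [hc]
    have : (∑ t, Function.extend φ c (0 : Fin n × Fin n → ℂ) (φ t) • M t) = ∑ t, c t • M t :=
      Finset.sum_congr rfl fun t _ => by rw [φ.injective.extend_apply]
    rw [this, hcoe, hrepr]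
  · -- `W̄(N₁) ⊆ W̄(N)`
    intro v₁
    have hmem : (∑ t, v₁ (φ t) • M t) ∈ L := by
      rw [hcoe]; exact ((∑ t, v₁ (φ t) • B t : L)).2
    obtain ⟨v, hv⟩ := LinearMap.mem_range.mp hmem
    exact ⟨v, by rw [hval, ← hv, hT]⟩
  · -- freeness
    intro v hv e he
    rw [hval, hcoe] at hv
    have hv0 : (∑ t, v (φ t) • B t : L) = 0 := by
      ext1; simpa using hv
    have hcoef : ∀ t, v (φ t) = 0 := Fintype.linearIndependent_iff.mp B.linearIndependent (fun t => v (φ t)) hv0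
    -- `e` is one of the `φ t`
    by_contra hve
    apply he
    rw [hval]
    refine Finset.sum_eq_zero fun t _ => ?_
    have hne : φ t ≠ e := fun h => hve (h ▸ hcoef t)
    rw [Pi.single_apply, if_neg hne, zero_smul]

end Summit.ValiantsHypothesis.ValiantsHypothesis.Theorems.GrenetZeon.LongMassHomogenise

end
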